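/-
Copyright (c) 2026. All rights reserved.
Released under Apache 2.0 license as described in the file LICENSE.
Authors: abc-iut cell, prover seat abc-iut-w5-d144 (gen 6; row «COR510iv-SB′», brick E input «D1b»), over abc-iut-L4-t3's
`IotaOver` / `LamOverLink` add-ons, abc-iut-f-101's `logObsFamily` and this seat's `DiagramChainFamiliesOver.lean`.
-/
import Literature.AnabelianGeometry.AbsoluteAnabelian.Ltimes.LogFrobeniusObservablesOver
import Literature.AnabelianGeometry.AbsoluteAnabelian.Ltimes.LogFrobeniusLamOverLink
import Literature.AnabelianGeometry.AbsoluteAnabelian.Ltimes.LogFrobeniusObservablesOfIotaSquare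
import Literature.AnabelianGeometry.AbsoluteAnabelian.DiagramChainFamiliesOver
import Literature.AnabelianGeometry.AbsoluteAnabelian.DiagramOverTransport
import HarnessLib

/-!
# [AbsTopIII] Cor 5.5 (iii) / Def 5.4 (iv)(vii): the homotopies of the observable `S_log⊞_v` lie over `Th•[Z]`

S. Mochizuki, *Topics in absolute anabelian geometry III: global reconstruction algorithms*,
J. Math. Sci. Univ. Tokyo 22 (2015) 939–1156 [MochizukiAbsTopIII2015]; manuscript `paper:url-5493eb38cbb7`: Def 5.4 (iv)
p. 127 ("`λ⊞_{v,ν}` … lie over `Th•[Z]`"), (vii) p. 128 (the `ι⊞_{v,ε}`), (ii) p. 125 ("`log•_{T,T}` lies over `Th•`"), Cor 5.5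
p. 130 (the diagram `D•`, proviso on the space-link / post-log vertices), (iii) p. 131 (the observable `S_log⊞_v`), Rmk
3.5.1 p. 78 (structure functors: «a 'constant portion' … 'under the entire diagram'»).

WHAT.  The observable's diagram `D•_{≤2} ∪ {𝒩⊞_v}` (`logDiagramPlus v`) LIES OVER `Th•[Z] = ℰ•` through the structure
functors `𝒳_⋎, □ ↦ proj`, `𝒩⊞_v ↦ (𝒩⊞_v → 𝒩_v → Th•[Z])`, the arrows lying over by the interface's own isomorphisms
`logOver` (`log`), the unitor (`id_⋎`), `lamOver v ν` (`λ⊞_{v,ν}`): `logPlusOverE v` (abc-iut-L4-t12's `OverData`).  With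
respect to it:

* `isOver_logGenHom` — GIVEN abc-iut-L4-t3's add-ons `IotaOver` (the `ι⊞` lie over `Th•[Z]`) and `LamOverLink` (one
  over-structure at the identified space-link / post-log vertices), BOTH printed kinds of generator pairs of `S_log⊞_v`
  (abc-iut-f-101's `LogGen.pre` / `LogGen.post`, homotopy `logGenHom` = `ι⊞_{v,ε}` re-typed) carry OVER-homotopies
  (abc-iut-f-101's `OverData.IsOver`): the component computation of abc-iut-f-102's THEOREM B (`hpre` / `hpost`), here
  against the observable's own small over-datum (abc-iut-L4-t3's `IotaOver.toE_map_iota_heq_of_preLog` / `_spaceLink`);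
* `isOver_logObsFamily_η` — ★ hence EVERY homotopy of the constructed observable `logObsFamily v hsq` lies over `Th•[Z]`
  (this seat's `isOver_chainFamily_η`): the hypothesis «hover⊞» of the Cor 5.10 (iv)(b) compatibility closer (row
  «COR510iv-SB′», abc-iut-f-101's brick D2) in over-datum form, for every setting satisfying the two add-ons;
* `isOver_logObsFamily_η_map` — the same over any category under `Th•[Z]` (abc-iut-f-101's `IsOver.map`,
  `DiagramOverTransport.lean`; e.g. along `ℰ• → ℰ⊢ ⥲ An⊢[𝒩⊢⊞]` of Cor 5.10 (iv)).

Interface-level (hypotheses `IotaOver`, `LamOverLink`, `IotaSquaresCommute`; no carrier); nothing here bears on [IUTchIII]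
Cor. 3.12; no side taken; typed ≠ proved.

**`⋉`-TWIN (cell row «LTIMES-SUCCESSOR», L4-lead m162; typing finding T3g9-F1).**  This file is the verbatim
re-elaboration of `LogFrobeniusObservablesOver.lean` over the successor interface `LogFrobeniusSettingLtimes`
(`Ltimes/LogFrobeniusCompatibility.lean`: `ι⊞_{v,ε}` indexed by the edges of `Γ⃗^⋉_v` at EVERY place, [AbsTopIII] Cor 5.5 (iii)
p. 131), produced by the cell recipe `LTIMES-RECIPE.md`: names carry over inside `namespace LogFrobeniusSettingLtimes`, the
section variable is `Lt`, setting-independent declarations are NOT repeated (the originals are in scope), statements and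
proofs are otherwise unchanged.  The original file over the frozen interface stays as it is.
NEW BASENAME `Ltimes/LogFrobeniusObservablesOverGenerators` (abc-iut-f-101 gen 6, slice T9-E «OBS@⋉-CARRIERS»): §2–§3 of the
frozen `LogFrobeniusObservablesOver` — the structure isomorphisms along the generator paths componentwise and ★ the over-ness
of the CONSTRUCTED family `logObsFamily` (`isOver_logGenHom`, `isOver_logObsFamily_η`, `isOver_logObsFamily_η_map` = the
`hoverPlus` binder of the E-instance), GIVEN the add-on laws `IotaOver` and `LamOverLink` over ⋉; §1 (`logPlusOverE`) is the
landed `Ltimes/LogFrobeniusObservablesOver`.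
-/

universe u

open CategoryTheory Quiver

namespace Literature.AnabelianGeometry.AbsoluteAnabelian

namespace LogFrobeniusSettingLtimes

variable {Vmod : Type u} {isArc : Vmod → Bool} (Lt : LogFrobeniusSettingLtimes Vmod isArc) (v : Vmod)

/-! ## The structure isomorphisms along the observable's generator paths, componentwise -/

/-- `F.map` respects heterogeneous equality of morphisms with equal endpoints. [folklore] -/
private theorem map_heq {C₁ D₁ : Type*} [Category C₁] [Category D₁] (F : C₁ ⥤ D₁) {X Y X' Y' : C₁} {f : X ⟶ Y} {g : X' ⟶ Y'}
    (hX : X = X') (hY : Y = Y') (h : HEq f g) : HEq (F.map f) (F.map g) := by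
  subst hX hY
  cases h
  rfl

/-- Components of a natural transformation at equal objects are heterogeneously equal. [folklore] -/
private theorem app_heq {C₁ D₁ : Type*} [Category C₁] [Category D₁] {F G : C₁ ⥤ D₁} (α : F ⟶ G) {y y' : C₁} (h : y = y') :
    HEq (α.app y) (α.app y') := by
  subst h
  rfl

/-- The path functor of the empty path on an object of `□` / `𝒳_⋎`. [cite: MochizukiAbsTopIII2015, Definition 3.5 (i) p.75] -/
private theorem pf_nil_obj (c : (logShapePlus (isArc := isArc) v).Vertex) (x : (Lt.logDiagramPlus v).obj c) :
    ((Lt.logDiagramPlus v).pathFunctor (Quiver.Path.nil : Quiver.Path c c)).obj x = x :=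
  (Lt.logDiagramPlus v).pathFunctor_nil_obj c x

/-- The empty path at `𝒳_{⋎+1}` (bookkeeping abbreviation). [cite: MochizukiAbsTopIII2015, Definition 3.5 (i) p.75] -/
private abbrev nilRow1 (n : ℤ) :
    Quiver.Path ((logShapePlus (isArc := isArc) v).base ⟨DVertex.row1 (n + 1), row1_mem_two (n + 1)⟩)
      ((logShapePlus (isArc := isArc) v).base ⟨DVertex.row1 (n + 1), row1_mem_two (n + 1)⟩) :=
  Quiver.Path.nil

/-- Along `[λ⊞_{v,ν}]`: the structure isomorphism is `lamOver v ν` (componentwise, heterogeneously — the path functor of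
`[λ⊞_ν]` is `𝟭 ⋙ λ⊞_ν`). [cite: MochizukiAbsTopIII2015, Def 5.4 (iv) p. 127] -/
theorem pathIso_lamPath_hom_app_heq (ν : LogVertex (isArc v)) (hν : ν.isPostLog = false) (x : Lt.X) :
    HEq (((Lt.logPlusOverE v).pathIso (lamPath v ν hν)).hom.app x) ((Lt.lamOver v ν).hom.app x) := by
  rw [show lamPath (isArc := isArc) v ν hν = Path.nil.cons (lamEdge v ν hν) from rfl,
    DiagramOfCategories.OverData.pathIso_cons_app, DiagramOfCategories.OverData.pathIso_nil_app]
  refine (eqToHom_comp_heq _ _).trans ((comp_eqToHom_heq _ _).trans ?_)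
  rw [logPlusOverE_μ_lamEdge]
  exact app_heq _ (Lt.pf_nil_obj v ((logShapePlus (isArc := isArc) v).base ⟨.core, core_mem_two⟩) x)

/-- Along `[λ⊞_{ν₂}] ∘ [id_{⋎+1}]`: the structure isomorphism is `lamOver v ν₂` (the unitor contributes an identity).
[cite: MochizukiAbsTopIII2015, Def 5.4 (iv) p. 127] -/
theorem pathIso_postLogCodPath_hom_app_heq (n : ℤ) (ν₂ : LogVertex (isArc v)) (h₂ : ν₂.isPostLog = false) (x : Lt.X) :
    HEq (((Lt.logPlusOverE v).pathIso (postLogCodPath v n ν₂ h₂)).hom.app x) ((Lt.lamOver v ν₂).hom.app x) := by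
  have hy₀ := Lt.pf_nil_obj v ((logShapePlus (isArc := isArc) v).base ⟨.row1 (n + 1), row1_mem_two (n + 1)⟩) x
  have hy₁ : ((Lt.logDiagramPlus v).pathFunctor (Path.nil.cons (toCoreEdge v (n + 1)))).obj x = x :=
    (Functor.congr_obj ((Lt.logDiagramPlus v).pathFunctor_cons Path.nil (toCoreEdge v (n + 1))) x).trans hy₀
  rw [show postLogCodPath (isArc := isArc) v n ν₂ h₂ = (Path.nil.cons (toCoreEdge v (n + 1))).cons (lamEdge v ν₂ h₂)
      from rfl,
    DiagramOfCategories.OverData.pathIso_cons_app, DiagramOfCategories.OverData.pathIso_cons_app,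
    DiagramOfCategories.OverData.pathIso_nil_app, logPlusOverE_μ_lamEdge, logPlusOverE_μ_toCoreEdge]
  refine (eqToHom_comp_heq _ _).trans ?_
  have e1 : HEq ((Lt.lamOver v ν₂).hom.app
      (((Lt.logDiagramPlus v).pathFunctor (Path.nil.cons (toCoreEdge v (n + 1)))).obj x)) ((Lt.lamOver v ν₂).hom.app x) :=
    app_heq _ hy₁
  have e2 : HEq (Lt.proj.leftUnitor.hom.app (((Lt.logDiagramPlus v).pathFunctor (nilRow1 (isArc := isArc) v n)).obj x))
      (𝟙 (Lt.proj.obj x)) := by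
    rw [hy₀]
    exact heq_of_eq (by simp)
  refine (heq_comp (by rw [hy₁]) (by rw [hy₁]; try rfl) rfl e1
    ((eqToHom_comp_heq _ _).trans ((comp_eqToHom_heq _ _).trans e2))).trans ?_
  exact heq_of_eq (Category.comp_id _)

/-- Along `[λ⊞_{space-link}] ∘ [id_⋎] ∘ [log]`: the structure isomorphism is `lamOver v space-link` at `log X` followed by
`logOver` at `X`. [cite: MochizukiAbsTopIII2015, Def 5.4 (ii) p. 125] -/
theorem pathIso_postLogDomPath_hom_app_heq (n : ℤ) (hsl : (LogVertex.spaceLink (isArc v)).isPostLog = false) (x : Lt.X) :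
    HEq (((Lt.logPlusOverE v).pathIso (postLogDomPath v n hsl)).hom.app x)
      ((Lt.lamOver v (LogVertex.spaceLink (isArc v))).hom.app (Lt.log.obj x) ≫ Lt.logOver.hom.app x) := by
  have hy₀ := Lt.pf_nil_obj v ((logShapePlus (isArc := isArc) v).base ⟨.row1 (n + 1), row1_mem_two (n + 1)⟩) x
  have hy₁ : ((Lt.logDiagramPlus v).pathFunctor (Path.nil.cons (logEdge v n))).obj x = Lt.log.obj x :=
    (Functor.congr_obj ((Lt.logDiagramPlus v).pathFunctor_cons Path.nil (logEdge v n)) x).trans (congrArg Lt.log.obj hy₀)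
  have hy₂ : ((Lt.logDiagramPlus v).pathFunctor ((Path.nil.cons (logEdge v n)).cons (toCoreEdge v n))).obj x =
      Lt.log.obj x :=
    (Functor.congr_obj ((Lt.logDiagramPlus v).pathFunctor_cons (Path.nil.cons (logEdge v n)) (toCoreEdge v n)) x).trans
      hy₁
  rw [show postLogDomPath (isArc := isArc) v n hsl =
      ((Path.nil.cons (logEdge v n)).cons (toCoreEdge v n)).cons (lamEdge v _ hsl) from rfl,
    DiagramOfCategories.OverData.pathIso_cons_app, DiagramOfCategories.OverData.pathIso_cons_app,
    DiagramOfCategories.OverData.pathIso_cons_app, DiagramOfCategories.OverData.pathIso_nil_app,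
    logPlusOverE_μ_lamEdge, logPlusOverE_μ_toCoreEdge, logPlusOverE_μ_logEdge]
  refine (eqToHom_comp_heq _ _).trans ?_
  have e1 : HEq ((Lt.lamOver v (LogVertex.spaceLink (isArc v))).hom.app
      (((Lt.logDiagramPlus v).pathFunctor ((Path.nil.cons (logEdge v n)).cons (toCoreEdge v n))).obj x))
      ((Lt.lamOver v (LogVertex.spaceLink (isArc v))).hom.app (Lt.log.obj x)) :=
    app_heq _ hy₂
  have e2 : HEq (Lt.proj.leftUnitor.hom.app (((Lt.logDiagramPlus v).pathFunctor (Path.nil.cons (logEdge v n))).obj x))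
      (𝟙 (Lt.proj.obj (Lt.log.obj x))) := by
    rw [hy₁]
    exact heq_of_eq (by simp)
  have e3 : HEq (Lt.logOver.hom.app (((Lt.logDiagramPlus v).pathFunctor (nilRow1 (isArc := isArc) v n)).obj x))
      (Lt.logOver.hom.app x) :=
    app_heq _ hy₀
  -- the tail `unitor ≫ logOver`, casts stripped
  have e23 : HEq (Lt.proj.leftUnitor.hom.app (((Lt.logDiagramPlus v).pathFunctor (Path.nil.cons (logEdge v n))).obj x) ≫
      (eqToHom (by rw [DiagramOfCategories.pathFunctor_cons]; try rfl) ≫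
        Lt.logOver.hom.app (((Lt.logDiagramPlus v).pathFunctor (nilRow1 (isArc := isArc) v n)).obj x) ≫
        eqToHom (by rw [DiagramOfCategories.pathFunctor_nil]; try rfl)))
      (𝟙 (Lt.proj.obj (Lt.log.obj x)) ≫ Lt.logOver.hom.app x) :=
    heq_comp (congrArg (fun y => Lt.proj.obj y) hy₁) (congrArg (fun y => Lt.proj.obj y) hy₁) rfl e2
      ((eqToHom_comp_heq _ _).trans ((comp_eqToHom_heq _ _).trans e3))
  refine (heq_comp (by rw [hy₂]) (by rw [hy₂]; try rfl) rfl e1 ((eqToHom_comp_heq _ _).trans e23)).trans ?_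
  exact heq_of_eq (by simp)

/-! ## The generator homotopies of `S_log⊞_v` lie over `Th•[Z]` -/

/-- **Both printed kinds of generator pairs of `S_log⊞_v` carry OVER-homotopies**, GIVEN abc-iut-L4-t3's add-ons `IotaOver`
(the `ι⊞_{v,ε}` lie over `Th•[Z]`) and `LamOverLink` (one over-structure at the identified space-link / post-log vertices):
for the pre-log pairs `([λ⊞_{ν₁}], [λ⊞_{ν₂}])` by `IotaOver.toE_map_iota_heq_of_preLog`, for the post-log pairs
`([λ⊞_{sl}]∘[id_⋎]∘[log], [λ⊞_{ν₂}]∘[id_{⋎+1}])` by `IotaOver.toE_map_iota_heq_spaceLink` — abc-iut-f-102's `hpre` / `hpost`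
computation against the observable's own over-datum `logPlusOverE v`. [cite: MochizukiAbsTopIII2015, Def 5.4 (vii) p. 128] -/
theorem isOver_logGenHom (hι : Lt.IotaOver) (hΛ : Lt.LamOverLink) :
    ∀ ⦃c b : (logShapePlus (isArc := isArc) v).Vertex⦄ ⦃g g' : Path c b⦄ (s : LogGen v g g'),
      (Lt.logPlusOverE v).IsOver g g' (Lt.logGenHom v s)
  | _, _, _, _, LogGen.pre ν₁ ν₂ ε h₁ h₂ => by
    refine (Iso.eq_comp_inv _).mpr ?_
    ext x
    rw [NatTrans.comp_app, Functor.whiskerRight_app]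
    apply eq_of_heq
    refine HEq.trans ?_ (Lt.pathIso_lamPath_hom_app_heq v ν₁ h₁ x).symm
    -- the homotopy, pushed down to `Th•[Z]`, is `A_{ν₁} ∘ A_{ν₂}⁻¹`
    have hθ : HEq (((Lt.logPlusOverE v).N (logShapePlus (isArc := isArc) v).obs).map
        ((Lt.logGenHom v (LogGen.pre ν₁ ν₂ ε h₁ h₂)).app x))
        ((Lt.lamOver v ν₁).hom.app x ≫ (Lt.lamOver v ν₂).inv.app x) := by
      have k : HEq ((Lt.logGenHom v (LogGen.pre ν₁ ν₂ ε h₁ h₂)).app x) ((Lt.iota v ε).app x) := by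
        simp only [logGenHom, NatTrans.comp_app, eqToHom_app]
        exact (eqToHom_comp_heq _ _).trans (comp_eqToHom_heq _ _)
      exact (map_heq (Lt.forget v ⋙ Lt.toE v) (Functor.congr_obj (Lt.pathFunctor_lamPath v ν₁ h₁) x)
        (Functor.congr_obj (Lt.pathFunctor_lamPath' v ν₂ h₂) x).symm k).trans (hι.toE_map_iota_heq_of_preLog v ε h₁ x)
    have hP := Lt.pathIso_lamPath_hom_app_heq v ν₂ h₂ x
    refine (heq_comp ?_ ?_ rfl hθ hP).trans (heq_of_eq (by simp))
    · exact (congrArg (fun F => (Lt.forget v ⋙ Lt.toE v).obj (F.obj x)) (Lt.pathFunctor_lamPath v ν₁ h₁)).trans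
        (by rw [h₁]; try rfl)
    · exact congrArg (fun F => (Lt.forget v ⋙ Lt.toE v).obj (F.obj x)) (Lt.pathFunctor_lamPath' v ν₂ h₂).symm
  | _, _, _, _, LogGen.post ν₁ ν₂ ε h₁ h₂ hsl n => by
    refine (Iso.eq_comp_inv _).mpr ?_
    ext x
    rw [NatTrans.comp_app, Functor.whiskerRight_app]
    apply eq_of_heq
    refine HEq.trans ?_ (Lt.pathIso_postLogDomPath_hom_app_heq v n hsl x).symm
    -- the homotopy, pushed down to `Th•[Z]`, is `A_{sl, log X} ∘ Ξ_X ∘ A_{ν₂,X}⁻¹` (uses `LamOverLink`)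
    have hθ : HEq (((Lt.logPlusOverE v).N (logShapePlus (isArc := isArc) v).obs).map
        ((Lt.logGenHom v (LogGen.post ν₁ ν₂ ε h₁ h₂ hsl n)).app x))
        (((Lt.lamOver v (LogVertex.spaceLink (isArc v))).hom.app (Lt.log.obj x) ≫ Lt.logOver.hom.app x) ≫
          (Lt.lamOver v ν₂).inv.app x) := by
      have k : HEq ((Lt.logGenHom v (LogGen.post ν₁ ν₂ ε h₁ h₂ hsl n)).app x) ((Lt.iota v ε).app x) := by
        simp only [logGenHom, NatTrans.comp_app, eqToHom_app]
        exact (eqToHom_comp_heq _ _).trans (comp_eqToHom_heq _ _)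
      refine (map_heq (Lt.forget v ⋙ Lt.toE v) (Functor.congr_obj (Lt.pathFunctor_postLogDomPath v ν₁ h₁ n hsl) x)
        (Functor.congr_obj (Lt.pathFunctor_postLogCodPath v n ν₂ h₂) x).symm k).trans ?_
      exact (hι.toE_map_iota_heq_spaceLink hΛ v ε h₁ x).trans (heq_of_eq (Category.assoc _ _ _).symm)
    have hP := Lt.pathIso_postLogCodPath_hom_app_heq v n ν₂ h₂ x
    refine (heq_comp ?_ ?_ rfl hθ hP).trans (heq_of_eq (by simp))
    · refine (congrArg (fun F => (Lt.forget v ⋙ Lt.toE v).obj (F.obj x)) (Lt.pathFunctor_postLogDomPath v ν₁ h₁ n hsl)).trans ?_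
      rw [h₁, LogVertex.eq_postLog_of_isPostLog _ h₁, ← Lt.lam_spaceLink_eq_postLog v]
      rfl
    · exact congrArg (fun F => (Lt.forget v ⋙ Lt.toE v).obj (F.obj x)) (Lt.pathFunctor_postLogCodPath v n ν₂ h₂).symm

/-- ★ **Every homotopy of the constructed observable `S_log⊞_v` lies over `Th•[Z]`** (GIVEN `IotaOver`, `LamOverLink`, and
the square hypothesis under which abc-iut-f-101's `logObsFamily` exists): the generators do (`isOver_logGenHom`), hence
every chain composite does (this seat's `isOver_chainFamily_η`).  The hypothesis «hover⊞» of the Cor 5.10 (iv)(b)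
compatibility closer in over-datum form. [cite: MochizukiAbsTopIII2015, Cor 5.5 (iii) p. 131] -/
theorem isOver_logObsFamily_η (hι : Lt.IotaOver) (hΛ : Lt.LamOverLink) (hsq : Lt.IotaSquaresCommute v)
    {a b : (logShapePlus (isArc := isArc) v).Vertex} {p q : Path a b} (h : (Lt.logObsFamily v hsq).E p q) :
    (Lt.logPlusOverE v).IsOver p q ((Lt.logObsFamily v hsq).η h) :=
  DiagramOfCategories.isOver_chainFamily_η (Lt.logPlusOverE v) (LogGen v) (Lt.logGenHom v)
    (Lt.isOver_logGenHom v hι hΛ) (logShapePlus v).obs (isEmpty_hom_logObs v)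
    (fun p q c c' => Lt.chain_hom_eq v hsq p q c c') h

/-- The same over any category UNDER `Th•[Z]` (post-composition of the structure functors with a functor
`F : Th•[Z] ⥤ 𝒞′`, e.g. the mono-analyticisation `Th•[Z] → Th⊢[Z] ⥲ An⊢[𝒩⊢⊞]` of Cor 5.10 (iv)): `IsOver.map`.
[cite: MochizukiAbsTopIII2015, Cor 5.10 (iv)(b) p. 147] -/
theorem isOver_logObsFamily_η_map (hι : Lt.IotaOver) (hΛ : Lt.LamOverLink) (hsq : Lt.IotaSquaresCommute v)
    {C' : Type (u + 1)} [Category.{u} C'] (F : Lt.E ⥤ C')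
    {a b : (logShapePlus (isArc := isArc) v).Vertex} {p q : Path a b} (h : (Lt.logObsFamily v hsq).E p q) :
    ((Lt.logPlusOverE v).map F).IsOver p q ((Lt.logObsFamily v hsq).η h) :=
  DiagramOfCategories.OverData.IsOver.map F (Lt.isOver_logObsFamily_η v hι hΛ hsq h)

end LogFrobeniusSettingLtimes

end Literature.AnabelianGeometry.AbsoluteAnabelian
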